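import Mathlib
import Summits.Ventures.PercRepro2.MixChordOStarMasses
import Summits.Ventures.PercRepro2.MixChordOStarKey
import Summits.Ventures.PercRepro2.MixChordOLeafRoot
import Summits.Ventures.PercRepro2.A3RootEdgeAll

/-!
# THE `o`–ROOT STAR: the `o`-class `D`-chord along `{o, a₁}` (blind cell PercRepro2, night-1 g24;
proofs/NIGHT1-G24.md §5)

`a₃` has exactly the two edges `g = {a₃, o}` (weight `r`) and `e = {a₃, a₁}` (weight `t`) — the first
one-component class of `G − {a₁, a₂}` beyond the leaf at `o`, where g23's scaling mechanism does not apply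
and `(S)` itself fails.  **`dChord_o_edge_of_o_root_star`**: the `o`-class `D`-chord
`(1 − q)·Gc(p[f ↦ 0])·D(p) ≤ Gc(p)·D(p[f ↦ 0])` along the `o`-edge `f = {o, a₁}` (`NMixChord normD`).
Proof: the dictionary `Gc_star` / `D_star` (MixChordOStarMasses.lean) writes `Gc` and `D` of `p` and of
`p[f ↦ 0]` in the masses of the base instance `p₀₀ = p[g ↦ 0][e ↦ 0]`; the `o`-edge pin `prob_eq_pin`
writes the masses of `p₀₀` as mixtures of those at `p₀₀[f ↦ 0]` and `p₀₀[f ↦ 1]`; at `p₀₀[f ↦ 1]` `o ∈ C₁`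
surely (g19's identifications) and g18's couplings give `Z¹ = Z⁰ − Ho⁰`, `B¹ = Hb⁰ − HH⁰`,
`L¹ ≥ Lb⁰ − HL⁰` (`W ≥ 0`); the nonnegativity of `Z⁰`, `Ho⁰`, `Z⁰ − Lo⁰`, `Z⁰ − Ho⁰`, `P⁰(PD_o) = Z⁰ − Lo⁰ − Ho⁰`
and the FOUR BHK facts at `p₀₀[f ↦ 0]` — the same-cluster BHK at `a₂` (`covC_same_nonneg`, root-swapped),
the two cross-cluster BHK (`covC_cross_nonpos`) and the same-cluster BHK at `a₂` with `a₁` avoiding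
`{a₂, o}` (`bhk_oH_bH_avoid`) — are the hypotheses of the algebraic key `star_key`
(MixChordOStarKey.lean).  **`HCov_o_root_star`**: (HCOV) on the star — p5's root-edge closure `HCov_of_update_zero` at `e` from
typer-1's `HCov_pendant_o` at `p[e ↦ 0]` through g23's support transport (`e` has weight `0` there);
hence the chain's row **`dz2Chord_o_edge_of_o_root_star`** (`NMixChord normDZ2`) by g22's weakening
lemma.  The support version (zero-weight edges at `a₃`) is left to the next file.  Own code; standard
axioms.
-/

namespace Summit.Ventures.PercRepro2

open UnionCluster CovForm

namespace Mix

namespace OStar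

section Main

variable {V : Type*} {E : Type*} [Fintype E] [DecidableEq E] [Fintype V] [DecidableEq V] {R : Type*}
  [Field R] [LinearOrder R] [IsStrictOrderedRing R]

variable (p : E → R) (ends : E → Sym2 V) {o a₁ a₂ a₃ : V} (b : V) {g e f : E}

omit [Fintype E] [DecidableEq E] [Fintype V] [DecidableEq V] [Field R] [LinearOrder R] [IsStrictOrderedRing R] in
/-- The two edges of the star are distinct. -/
lemma star_ne_ge (hg : ends g = s(a₃, o)) (he : ends e = s(a₃, a₁)) (h13 : a₁ ≠ a₃) (ho1 : o ≠ a₁) :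
    g ≠ e := by
  intro h
  rw [h, he] at hg
  rcases Sym2.eq_iff.1 hg with ⟨-, h2⟩ | ⟨-, h2⟩
  · exact ho1 h2.symm
  · exact h13 h2

omit [Fintype E] [DecidableEq E] [Fintype V] [DecidableEq V] [Field R] [LinearOrder R] [IsStrictOrderedRing R] in
/-- The edge `{a₃, o}` is not the `o`-edge. -/
lemma star_ne_gf (hg : ends g = s(a₃, o)) (hf : ends f = s(o, a₁)) (h13 : a₁ ≠ a₃) (ho3 : o ≠ a₃) :
    g ≠ f := by
  intro h
  rw [h, hf] at hg
  rcases Sym2.eq_iff.1 hg with ⟨h1, -⟩ | ⟨-, h2⟩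
  · exact ho3 h1
  · exact h13 h2

omit [Fintype E] [DecidableEq E] [Fintype V] [DecidableEq V] [Field R] [LinearOrder R] [IsStrictOrderedRing R] in
/-- The edge `{a₃, a₁}` is not the `o`-edge. -/
lemma star_ne_ef (he : ends e = s(a₃, a₁)) (hf : ends f = s(o, a₁)) (h13 : a₁ ≠ a₃) (ho3 : o ≠ a₃) :
    e ≠ f := by
  intro h
  rw [h, hf] at he
  rcases Sym2.eq_iff.1 he with ⟨h1, -⟩ | ⟨-, h2⟩
  · exact ho3 h1
  · exact h13 h2

omit [Fintype E] [Fintype V] [DecidableEq V] [LinearOrder R] [IsStrictOrderedRing R] in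
/-- `p[f ↦ 0][g ↦ 0][e ↦ 0] = p[g ↦ 0][e ↦ 0][f ↦ 0]`. -/
lemma upd_f0 (hgf : g ≠ f) (hef : e ≠ f) :
    Function.update (Function.update (Function.update p f 0) g 0) e 0 =
      Function.update (Function.update (Function.update p g 0) e 0) f 0 := by
  rw [Function.update_comm hgf.symm, Function.update_comm hef.symm]

/-- **THE `o`–ROOT STAR: the `o`-class `D`-chord along `f = {o, a₁}`** (`NMixChord normD`), for `a₃` with
exactly the two edges `g = {a₃, o}` and `e = {a₃, a₁}` (any weights). -/
theorem dChord_o_edge_of_o_root_star (hp : IsProbVec p) (hf : ends f = s(o, a₁)) (hg : ends g = s(a₃, o))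
    (he : ends e = s(a₃, a₁)) (hstar : ∀ e', a₃ ∈ ends e' → e' = g ∨ e' = e)
    (h13 : a₁ ≠ a₃) (h23 : a₂ ≠ a₃) (ho1 : o ≠ a₁) (ho3 : o ≠ a₃) (hb3 : b ≠ a₃) :
    NMixChord (normD ends a₁ a₂ a₃) p ends o a₁ a₂ a₃ b f := by
  have hge : g ≠ e := star_ne_ge ends hg he h13 ho1
  have hgf : g ≠ f := star_ne_gf ends hg hf h13 ho3
  have hef : e ≠ f := star_ne_ef ends he hf h13 ho3
  have hpf : IsProbVec (Function.update p f 0) := hp.update f le_rfl zero_le_one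
  -- `Gc` vanishes with the `o`-edge open
  have hG1 : Gc (Function.update p f 1) ends o a₁ a₂ a₃ b = 0 :=
    Gc_eq_zero_of_sure_conn_o _ ends o a₃ b (conn_a1_o_of_update_one p ends hf)
  unfold NMixChord normD
  rw [hG1, mul_zero, sub_zero]
  -- the dictionary at `p` and at `p[f ↦ 0]`
  rw [Gc_star p hg he hstar hf hge hgf hef h13 h23 ho3 hb3, D_star p hg he hstar hf hge hgf hef h13 h23 ho3 hb3,
    Gc_star (Function.update p f 0) hg he hstar hf hge hgf hef h13 h23 ho3 hb3,
    D_star (Function.update p f 0) hg he hstar hf hge hgf hef h13 h23 ho3 hb3,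
    upd_f0 p hgf hef, Function.update_idem, Function.update_of_ne hgf, Function.update_of_ne hef]
  -- the base instance and its `o`-edge pins
  set p₀₀ := Function.update (Function.update p g 0) e 0 with hp₀₀
  have hp00 : IsProbVec p₀₀ := (hp.update g le_rfl zero_le_one).update e le_rfl zero_le_one
  have hp0 : IsProbVec (Function.update p₀₀ f 0) := hp00.update f le_rfl zero_le_one
  have hp1 : IsProbVec (Function.update p₀₀ f 1) := hp00.update f zero_le_one le_rfl
  have hqf : p₀₀ f = p f := by rw [hp₀₀, Function.update_of_ne hef.symm, Function.update_of_ne hgf.symm]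
  -- at `p₀₀[f ↦ 1]`, `o ∈ C₁` surely
  have hc1 := conn_a1_o_of_update_one p₀₀ ends hf
  have hHo1 := prob_Q_conn₂_eq_zero (Function.update p₀₀ f 1) ends (a₂ := a₂) hc1
  have hLo1 := prob_inter_conn_eq' (Function.update p₀₀ f 1) ends hc1 (avoidAll ends a₂ {a₁})
  have hLH1 := prob_inter_conn_eq (Function.update p₀₀ f 1) ends hc1 (avoidAll ends a₂ {a₁}) (connEvent ends a₂ b)
  have hHL1 := prob_inter_conn₂_eq_zero (Function.update p₀₀ f 1) ends (a₂ := a₂) hc1 (avoidAll ends a₂ {a₁}) (connEvent ends a₁ b) le_rfl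
  have hHH1 := prob_inter_conn₂_eq_zero (Function.update p₀₀ f 1) ends (a₂ := a₂) hc1 (avoidAll ends a₂ {a₁}) (connEvent ends a₂ b) le_rfl
  -- g18's couplings across the `o`-edge
  have hZ1 := RootEdge.prob_Q_update_one p₀₀ ends (a₂ := a₂) hf
  rw [TEvent_o] at hZ1
  have hB1 := RootEdge.prob_Q_conn2_update_one p₀₀ ends (a₂ := a₂) hf b
  rw [TEvent_o_inter] at hB1
  have hL1 := RootEdge.prob_Q_conn1_update_one_ge p₀₀ ends (a₂ := a₂) hp00 hf b
  rw [TEvent_o_inter] at hL1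
  -- the pins of the `o`-edge
  have pZ := prob_eq_pin p₀₀ (avoidAll ends a₂ {a₁}) f
  have pLo := prob_eq_pin p₀₀ (avoidAll ends a₂ {a₁} ∩ connEvent ends a₁ o) f
  have pHo := prob_eq_pin p₀₀ (avoidAll ends a₂ {a₁} ∩ connEvent ends a₂ o) f
  have pLb := prob_eq_pin p₀₀ (avoidAll ends a₂ {a₁} ∩ connEvent ends a₁ b) f
  have pHb := prob_eq_pin p₀₀ (avoidAll ends a₂ {a₁} ∩ connEvent ends a₂ b) f
  have pLH := prob_eq_pin p₀₀ (avoidAll ends a₂ {a₁} ∩ (connEvent ends a₁ o ∩ connEvent ends a₂ b)) f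
  have pHL := prob_eq_pin p₀₀ (avoidAll ends a₂ {a₁} ∩ (connEvent ends a₂ o ∩ connEvent ends a₁ b)) f
  have pHH := prob_eq_pin p₀₀ (avoidAll ends a₂ {a₁} ∩ (connEvent ends a₂ o ∩ connEvent ends a₂ b)) f
  rw [hqf] at pZ pLo pHo pLb pHb pLH pHL pHH
  -- the nonnegative masses at `p₀₀[f ↦ 0]`
  have hZ0n := prob_nonneg hp0 (avoidAll ends a₂ {a₁})
  have hHo0n := prob_nonneg hp0 (avoidAll ends a₂ {a₁} ∩ connEvent ends a₂ o)
  have hZmLo : 0 ≤ prob (Function.update p₀₀ f 0) (avoidAll ends a₂ {a₁}) - prob (Function.update p₀₀ f 0) (avoidAll ends a₂ {a₁} ∩ connEvent ends a₁ o) :=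
    sub_nonneg.2 (prob_inter_le_left hp0 _ _)
  have hZmHo : 0 ≤ prob (Function.update p₀₀ f 0) (avoidAll ends a₂ {a₁}) - prob (Function.update p₀₀ f 0) (avoidAll ends a₂ {a₁} ∩ connEvent ends a₂ o) :=
    sub_nonneg.2 (prob_inter_le_left hp0 _ _)
  have hN0 : 0 ≤ prob (Function.update p₀₀ f 0) (avoidAll ends a₂ {a₁}) - prob (Function.update p₀₀ f 0) (avoidAll ends a₂ {a₁} ∩ connEvent ends a₁ o) -
      prob (Function.update p₀₀ f 0) (avoidAll ends a₂ {a₁} ∩ connEvent ends a₂ o) := by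
    have h := prob_PD_v_univ (Function.update p₀₀ f 0) ends a₁ a₂ o
    have h0 := prob_nonneg hp0 (PDEvent ends a₁ a₂ o)
    linarith
  -- the four BHK facts at `p₀₀[f ↦ 0]`
  have hs2n := PendantRoot.covC_same_nonneg (Function.update p₀₀ f 0) ends hp0 o a₂ a₁ b
  rw [covC_root_swap] at hs2n
  unfold PendantRoot.covC at hs2n
  have hs34 := PendantRoot.covC_cross_nonpos (Function.update p₀₀ f 0) ends hp0 o a₁ a₂ b
  unfold PendantRoot.covC at hs34
  obtain ⟨hs4n, hs3n⟩ := hs34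
  have hs10n := bhk_oH_bH_avoid (Function.update p₀₀ f 0) ends b hp0 o a₁ a₂
  -- the algebraic key
  have hq0 := hp.nonneg f
  have hq1 := hp.le_one f
  have hr0 := hp.nonneg g
  have hr1 := hp.le_one g
  have ht0 := hp.nonneg e
  have ht1 := hp.le_one e
  exact star_key _ _ _ _ _ _ _ _ _ _ _ _ _ _ _ _ _ _ _ _ _
    (prob (Function.update p₀₀ f 1) (avoidAll ends a₂ {a₁} ∩ connEvent ends a₁ b) - (prob (Function.update p₀₀ f 0) (avoidAll ends a₂ {a₁} ∩ connEvent ends a₁ b) -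
      prob (Function.update p₀₀ f 0) (avoidAll ends a₂ {a₁} ∩ (connEvent ends a₂ o ∩ connEvent ends a₁ b))))
    (p f) (p g) (p e) (1 - p f) (1 - p g) (1 - p e) _ _ _ _
    hr0 ht0 rfl rfl (sub_nonneg.2 hr1) (sub_nonneg.2 ht1) hq0 rfl (sub_nonneg.2 hq1)
    hZ0n hHo0n hZmLo hZmHo hN0 (sub_nonneg.2 hL1)
    (by rw [hZ1]) (by ring) (by rw [hB1])
    (by rw [pZ]; ring) (by rw [pLo, hLo1]; ring) (by rw [pHo, hHo1]; ring)
    (by rw [pLb]; ring) (by rw [pHb]; ring) (by rw [pLH, hLH1]; ring)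
    (by rw [pHL, hHL1]; ring) (by rw [pHH, hHH1]; ring)
    rfl rfl rfl rfl hs2n (by linarith) (by linarith) (by linarith)

/-- **(HCOV) on the `o`–root star**: p5's root-edge closure at `e = {a₃, a₁}` from typer-1's leaf at `o`
(through the support transport, `e` having weight `0` in `p[e ↦ 0]`). -/
theorem HCov_o_root_star (hp : IsProbVec p) (hg : ends g = s(a₃, o)) (he : ends e = s(a₃, a₁))
    (hstar : ∀ e', a₃ ∈ ends e' → e' = g ∨ e' = e) (h13 : a₁ ≠ a₃) (h23 : a₂ ≠ a₃) (ho1 : o ≠ a₁)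
    (ho3 : o ≠ a₃) (hb3 : b ≠ a₃) : HCov p ends o a₁ a₂ a₃ b := by
  have hge : g ≠ e := star_ne_ge ends hg he h13 ho1
  have h0 : HCov (Function.update p e 0) ends o a₁ a₂ a₃ b := by
    have hleaf : ∀ e', a₃ ∈ ends e' → e' ≠ g → Function.update p e 0 e' = 0 := by
      intro e' h3 hne
      rcases hstar e' h3 with h | h
      · exact absurd h hne
      · rw [h, Function.update_self]
    have hS := Support.leafSupport_zero (Function.update p e 0) ends hleaf
    rw [Support.HCov_restrict_iff _ hS ends o a₁ a₂ a₃ b]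
    exact PendantO.HCov_pendant_o _ _ (Support.isProbVec_restrict _ _ (hp.update e le_rfl zero_le_one))
      (f := ⟨g, Support.self_mem_leafSupport ends⟩) hg (Support.leaf_restrict ends _) ho3.symm h13.symm
      h23.symm hb3
  exact RootEdge.HCov_of_update_zero p hp ends o a₁ a₂ a₃ b e (by rw [he, Sym2.eq_swap]) h0

/-- **The chain's row on the `o`–root star**: the `(D·Z)²`-chord `NMixChord normDZ2` along `{o, a₁}`. -/
theorem dz2Chord_o_edge_of_o_root_star (hp : IsProbVec p) (hf : ends f = s(o, a₁))
    (hg : ends g = s(a₃, o)) (he : ends e = s(a₃, a₁)) (hstar : ∀ e', a₃ ∈ ends e' → e' = g ∨ e' = e)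
    (h13 : a₁ ≠ a₃) (h23 : a₂ ≠ a₃) (ho1 : o ≠ a₁) (ho3 : o ≠ a₃) (hb3 : b ≠ a₃) :
    NMixChord (normDZ2 ends a₁ a₂ a₃) p ends o a₁ a₂ a₃ b f :=
  nMixChord_DZ2_of_D hp (dChord_o_edge_of_o_root_star p ends b hp hf hg he hstar h13 h23 ho1 ho3 hb3)
    (HCov_o_root_star (Function.update p f 0) ends b (hp.update f le_rfl zero_le_one) hg he hstar h13 h23 ho1
      ho3 hb3)

end Main

end OStar

end Mix

end Summit.Ventures.PercRepro2
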